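import Literature.Topology.FourManifolds.IwaseToriTools
import Mathlib.Analysis.SpecialFunctions.Trigonometric.ArctanDeriv
import Mathlib.Analysis.SpecialFunctions.Trigonometric.Bounds
import Mathlib.Analysis.Real.Pi.Bounds
import HarnessLib

/-!
# The loop parametrisation of the handle zone of the Iwase tori

Auxiliary construction for the tubular neighbourhood maps of the model datum of Iwase's
Proposition 3.5 [cite: Iwase1988, Prop. 3.5, p. 296].  The core torus is parametrised by a loop
coordinate `t ∈ ℝ/4ℤ`: on the graph zone `t` is the height of the core point, on the handle
zone the handle parameter is `u = loopU t`.  At the northern junction the two must match: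
the handle slice `u` has radius `r(u) = 49/50 + tan (π u)` and the core point of height `t` has
`r = t²`, whence the germ `σ_N(t) = arctan (t² - 49/50)/π`; symmetrically `σ_S` at the southern
junction; `loopU` glues these germs to an affine middle (and affine far pieces) with
`smoothTransition` cut-offs, using the *sign* form of the monotone gluing (`deriv_glue_pos`,
`glue_sign`) — no derivative bounds on the cut-offs are needed.

Main results: `contDiff_loopU`, `deriv_loopU_pos`, `strictMono_loopU`, `surjective_loopU`,
the smooth inverse `loopT` (`contDiff_loopT`), the junction identities `loopU_eq_sigN`,
`tan_pi_mul_loopU` (`r(loopU t) = t²` on `[19/20, 1]`), `loopU_sqrt` / `loopU_mem_Ioo` (the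
handle zone is `t ∈ (√(49/50), 4 - √(49/50))`), `loopU_le_of_le` (`t ≤ 0.993 ⇒ u ≤ 1/500`).

All statements are elementary [folklore].

## References
* Z. Iwase, *Dehn-surgery along a torus T²-knot*, Pacific J. Math. 133 (1988), 289–299,
  Prop. 3.5. [cite: Iwase1988]
-/

open scoped ContDiff Topology
open Set Function Real Filter

noncomputable section

namespace Literature.Topology.FourManifolds

namespace IwaseTori

/-! ### The pieces -/

/-- **The northern junction germ** `σ_N(t) = arctan (t² - 49/50) / π`: the handle parameter
`u` of the core point of height `t` (`r(u) = 49/50 + tan (π u) = t²`). [folklore] -/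
def sigN (t : ℝ) : ℝ := arctan (t ^ 2 - 49 / 50) / π

/-- **The southern junction germ** `σ_S(t) = 1 - σ_N(4 - t)`. [folklore] -/
def sigS (t : ℝ) : ℝ := 1 - sigN (4 - t)

/-- **The affine middle** `M(t) = 1/2 + (2/5)(t - 2)`. [folklore] -/
def sigM (t : ℝ) : ℝ := 1 / 2 + 2 / 5 * (t - 2)

/-- `σ_N` is smooth. [folklore] -/
theorem contDiff_sigN : ContDiff ℝ ∞ sigN :=
  (contDiff_arctan.comp ((contDiff_id.pow 2).sub contDiff_const)).div_const _

/-- `σ_S` is smooth. [folklore] -/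
theorem contDiff_sigS : ContDiff ℝ ∞ sigS :=
  contDiff_const.sub (contDiff_sigN.comp (contDiff_const.sub contDiff_id))

/-- `M` is smooth. [folklore] -/
theorem contDiff_sigM : ContDiff ℝ ∞ sigM := by unfold sigM; fun_prop

/-- The derivative of `σ_N`. [folklore] -/
theorem hasDerivAt_sigN (t : ℝ) :
    HasDerivAt sigN (2 * t / (1 + (t ^ 2 - 49 / 50) ^ 2) / π) t := by
  have h1 : HasDerivAt (fun t : ℝ => t ^ 2 - 49 / 50) (2 * t) t := by
    simpa using (hasDerivAt_pow 2 t).sub_const (49 / 50)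
  have h2 := h1.arctan
  show HasDerivAt (fun t => arctan (t ^ 2 - 49 / 50) / π) _ t
  exact (h2.div_const π).congr_deriv (by ring)

/-- `σ_N' = 2t / (π (1 + (t² - 49/50)²))`. [folklore] -/
theorem deriv_sigN (t : ℝ) : deriv sigN t = 2 * t / (1 + (t ^ 2 - 49 / 50) ^ 2) / π :=
  (hasDerivAt_sigN t).deriv

/-- `σ_N' > 0` for `t > 0`. [folklore] -/
theorem deriv_sigN_pos {t : ℝ} (ht : 0 < t) : 0 < deriv sigN t := by
  rw [deriv_sigN]; positivity

/-- The derivative of `σ_S`: `σ_S'(t) = σ_N'(4 - t)`. [folklore] -/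
theorem hasDerivAt_sigS (t : ℝ) : HasDerivAt sigS (deriv sigN (4 - t)) t := by
  have h1 : HasDerivAt (fun t : ℝ => 4 - t) (-1) t := by simpa using (hasDerivAt_id t).const_sub 4
  have h2 : HasDerivAt (fun t => sigN (4 - t)) (deriv sigN (4 - t) * -1) t :=
    (hasDerivAt_sigN (4 - t)).deriv ▸ ((contDiff_sigN.differentiable (by simp)) _).hasDerivAt.comp t h1
  show HasDerivAt (fun t => 1 - sigN (4 - t)) _ t
  exact (h2.const_sub 1).congr_deriv (by ring)

/-- `σ_S' > 0` for `t < 4`. [folklore] -/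
theorem deriv_sigS_pos {t : ℝ} (ht : t < 4) : 0 < deriv sigS t := by
  rw [(hasDerivAt_sigS t).deriv]; exact deriv_sigN_pos (by linarith)

/-- `M' = 2/5`. [folklore] -/
theorem deriv_sigM (t : ℝ) : deriv sigM t = 2 / 5 := by
  have : HasDerivAt sigM (2 / 5) t := by
    show HasDerivAt (fun t => 1 / 2 + 2 / 5 * (t - 2)) _ t
    exact ((((hasDerivAt_id t).sub_const 2).const_mul (2 / 5 : ℝ)).const_add (1 / 2)).congr_deriv
      (by simp)
  exact this.deriv

/-- `arctan x ≤ x` for `x ≥ 0`. [folklore] -/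
theorem arctan_le_self {x : ℝ} (hx : 0 ≤ x) : arctan x ≤ x := by
  have h1 : 0 ≤ arctan x := by rw [← arctan_zero]; exact arctan_strictMono.monotone hx
  have := Real.le_tan h1 (arctan_lt_pi_div_two x)
  rwa [tan_arctan] at this

/-- `|arctan x| ≤ |x|`. [folklore] -/
theorem abs_arctan_le (x : ℝ) : |arctan x| ≤ |x| := by
  rcases le_or_gt 0 x with h | h
  · rw [abs_of_nonneg (by rw [← arctan_zero]; exact arctan_strictMono.monotone h), abs_of_nonneg h]
    exact arctan_le_self h
  · have h' : arctan x < 0 := by rw [← arctan_zero]; exact arctan_strictMono h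
    rw [abs_of_neg h', abs_of_neg h, ← arctan_neg]
    exact arctan_le_self (by linarith)

/-- `|σ_N(t)| ≤ |t² - 49/50| / π`. [folklore] -/
theorem abs_sigN_le (t : ℝ) : |sigN t| ≤ |t ^ 2 - 49 / 50| / π := by
  rw [sigN, abs_div, abs_of_pos pi_pos]
  exact div_le_div_of_nonneg_right (abs_arctan_le _) pi_pos.le

/-- `σ_N(√(49/50)) = 0`. [folklore] -/
theorem sigN_sqrt : sigN (Real.sqrt (49 / 50)) = 0 := by
  rw [sigN, Real.sq_sqrt (by norm_num), sub_self, arctan_zero, zero_div]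

/-- `σ_N` is strictly increasing on `[0, ∞)`. [folklore] -/
theorem sigN_lt_sigN {s t : ℝ} (hs : 0 ≤ s) (hst : s < t) : sigN s < sigN t := by
  unfold sigN
  exact div_lt_div_of_pos_right (arctan_strictMono (by nlinarith)) pi_pos

/-- `tan (π σ_N(t)) = t² - 49/50`. [folklore] -/
theorem tan_pi_mul_sigN (t : ℝ) : tan (π * sigN t) = t ^ 2 - 49 / 50 := by
  rw [sigN, mul_div_cancel₀ _ pi_pos.ne', tan_arctan]

/-! ### The glued loop parameter of the handle zone -/

/-- The innermost glue: `σ_S` to the affine `t - 2` on `[61/20, 31/10]`. [folklore] -/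
def loopU3 (t : ℝ) : ℝ := (1 - cut (61 / 20) (31 / 10) t) * sigS t + cut (61 / 20) (31 / 10) t * (t - 2)

/-- `M` to `loopU3` on `[29/10, 3]`. [folklore] -/
def loopU2 (t : ℝ) : ℝ := (1 - cut (29 / 10) 3 t) * sigM t + cut (29 / 10) 3 t * loopU3 t

/-- `σ_N` to `loopU2` on `[1, 11/10]`. [folklore] -/
def loopU1 (t : ℝ) : ℝ := (1 - cut 1 (11 / 10) t) * sigN t + cut 1 (11 / 10) t * loopU2 t

/-- **The handle parameter `u = loopU t` of the loop coordinate `t`**: the affine `t - 1` for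
`t ≤ 9/10`, the junction germ `σ_N` on `[19/20, 1]`, affine in the middle, the germ `σ_S` on
`[3, 61/20]`, the affine `t - 2` for `t ≥ 31/10`; smooth and strictly increasing on `ℝ`.
[folklore] -/
def loopU (t : ℝ) : ℝ := (1 - cut (9 / 10) (19 / 20) t) * (t - 1) + cut (9 / 10) (19 / 20) t * loopU1 t

/-- `loopU3` is smooth. [folklore] -/
theorem contDiff_loopU3 : ContDiff ℝ ∞ loopU3 := by
  unfold loopU3
  exact ((contDiff_const.sub (contDiff_cut _ _)).mul contDiff_sigS).add
    ((contDiff_cut _ _).mul (contDiff_id.sub contDiff_const))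

/-- `loopU2` is smooth. [folklore] -/
theorem contDiff_loopU2 : ContDiff ℝ ∞ loopU2 := by
  unfold loopU2
  exact ((contDiff_const.sub (contDiff_cut _ _)).mul contDiff_sigM).add
    ((contDiff_cut _ _).mul contDiff_loopU3)

/-- `loopU1` is smooth. [folklore] -/
theorem contDiff_loopU1 : ContDiff ℝ ∞ loopU1 := by
  unfold loopU1
  exact ((contDiff_const.sub (contDiff_cut _ _)).mul contDiff_sigN).add
    ((contDiff_cut _ _).mul contDiff_loopU2)

/-- **`loopU` is smooth.** [folklore] -/
theorem contDiff_loopU : ContDiff ℝ ∞ loopU := by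
  unfold loopU
  exact ((contDiff_const.sub (contDiff_cut _ _)).mul (contDiff_id.sub contDiff_const)).add
    ((contDiff_cut _ _).mul contDiff_loopU1)

/-- `loopU = t - 1` for `t ≤ 9/10`. [folklore] -/
theorem loopU_of_le {t : ℝ} (ht : t ≤ 9 / 10) : loopU t = t - 1 := by
  rw [loopU, cut_of_le (by norm_num) ht]; ring

/-- **`loopU = σ_N` on `[19/20, 1]`** (the northern junction). [folklore] -/
theorem loopU_eq_sigN {t : ℝ} (h1 : 19 / 20 ≤ t) (h2 : t ≤ 1) : loopU t = sigN t := by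
  rw [loopU, cut_of_ge (by norm_num) h1, loopU1, cut_of_le (by norm_num) h2]; ring

/-- **`loopU = σ_S` on `[3, 61/20]`** (the southern junction). [folklore] -/
theorem loopU_eq_sigS {t : ℝ} (h1 : 3 ≤ t) (h2 : t ≤ 61 / 20) : loopU t = sigS t := by
  rw [loopU, cut_of_ge (by norm_num) (by linarith : (19 / 20 : ℝ) ≤ t), loopU1,
    cut_of_ge (by norm_num) (by linarith : (11 / 10 : ℝ) ≤ t), loopU2, cut_of_ge (by norm_num) h1,
    loopU3, cut_of_le (by norm_num) h2]
  ring

/-- `loopU = t - 2` for `t ≥ 31/10`. [folklore] -/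
theorem loopU_of_ge {t : ℝ} (ht : 31 / 10 ≤ t) : loopU t = t - 2 := by
  rw [loopU, cut_of_ge (by norm_num) (by linarith : (19 / 20 : ℝ) ≤ t), loopU1,
    cut_of_ge (by norm_num) (by linarith : (11 / 10 : ℝ) ≤ t), loopU2,
    cut_of_ge (by norm_num) (by linarith : (3 : ℝ) ≤ t), loopU3, cut_of_ge (by norm_num) ht]
  ring

/-! ### Positivity of the derivative -/

/-- The derivative of the cut-off vanishes below `a`. [folklore] -/
theorem deriv_cut_of_lt {a b x : ℝ} (hab : a < b) (hx : x < a) : deriv (cut a b) x = 0 := by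
  have hev : cut a b =ᶠ[𝓝 x] fun _ => (0 : ℝ) := by
    filter_upwards [(isOpen_lt continuous_id continuous_const).mem_nhds hx] with y hy
    exact cut_of_le hab hy.le
  rw [hev.deriv_eq, deriv_const]

/-- The derivative of the cut-off vanishes above `b`. [folklore] -/
theorem deriv_cut_of_gt {a b x : ℝ} (hab : a < b) (hx : b < x) : deriv (cut a b) x = 0 := by
  have hev : cut a b =ᶠ[𝓝 x] fun _ => (1 : ℝ) := by
    filter_upwards [(isOpen_lt continuous_const continuous_id).mem_nhds hx] with y hy
    exact cut_of_ge hab hy.le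
  rw [hev.deriv_eq, deriv_const]

/-- **The sign condition of the monotone gluing** reduces to `f ≤ g` on `[a, b]`. [folklore] -/
theorem glue_sign {f g : ℝ → ℝ} {a b : ℝ} (hab : a < b)
    (h : ∀ x, a ≤ x → x ≤ b → f x ≤ g x) (x : ℝ) : 0 ≤ (g x - f x) * deriv (cut a b) x := by
  by_cases hx : a ≤ x ∧ x ≤ b
  · exact mul_nonneg (by linarith [h x hx.1 hx.2]) (deriv_cut_nonneg hab x)
  · rw [not_and_or, not_le, not_le] at hx
    rcases hx with hx | hx
    · rw [deriv_cut_of_lt hab hx, mul_zero]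
    · rw [deriv_cut_of_gt hab hx, mul_zero]

/-- A two-sided bound: `-(49/50 - t²)⁺/π ≤ σ_N(t) ≤ (t² - 49/50)⁺/π`; we record the two useful
one-sided forms. `σ_N(t) ≥ -(49/50 - t²)/π` when `t² ≤ 49/50`. [folklore] -/
theorem sigN_ge_of_sq_le {t : ℝ} (ht : t ^ 2 ≤ 49 / 50) : -((49 / 50 - t ^ 2) / π) ≤ sigN t := by
  have hb := (abs_le.1 (abs_sigN_le t)).1
  rwa [abs_of_nonpos (by linarith), neg_sub] at hb

/-- `σ_N(t) ≤ (t² - 49/50)/π` when `t² ≥ 49/50`. [folklore] -/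
theorem sigN_le_of_le_sq {t : ℝ} (ht : 49 / 50 ≤ t ^ 2) : sigN t ≤ (t ^ 2 - 49 / 50) / π := by
  have hb := (abs_le.1 (abs_sigN_le t)).2
  rwa [abs_of_nonneg (by linarith)] at hb

/-- `σ_N ≥ 0` when `t² ≥ 49/50`. [folklore] -/
theorem sigN_nonneg {t : ℝ} (ht : 49 / 50 ≤ t ^ 2) : 0 ≤ sigN t := by
  rw [sigN]; exact div_nonneg (by rw [← arctan_zero]; exact arctan_strictMono.monotone (by linarith)) pi_pos.le

/-- `σ_N ≤ 0` when `t² ≤ 49/50`. [folklore] -/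
theorem sigN_nonpos {t : ℝ} (ht : t ^ 2 ≤ 49 / 50) : sigN t ≤ 0 := by
  rw [sigN]; exact div_nonpos_of_nonpos_of_nonneg
    (by rw [← arctan_zero]; exact arctan_strictMono.monotone (by linarith)) pi_pos.le

/-- **Glue 0**: `t - 1 ≤ σ_N(t)` on `[9/10, 19/20]`. [folklore] -/
theorem glue0_le {t : ℝ} (h1 : 9 / 10 ≤ t) (h2 : t ≤ 19 / 20) : t - 1 ≤ sigN t := by
  have hπ := pi_gt_three
  have := sigN_ge_of_sq_le (t := t) (by nlinarith)
  have key : (49 / 50 - t ^ 2) / π ≤ 1 - t := by rw [div_le_iff₀ pi_pos]; nlinarith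
  linarith

/-- **Glue 1**: `σ_N(t) ≤ M(t)` on `[1, 11/10]`. [folklore] -/
theorem glue1_le {t : ℝ} (h1 : 1 ≤ t) (h2 : t ≤ 11 / 10) : sigN t ≤ sigM t := by
  have hπ := pi_gt_three
  have := sigN_le_of_le_sq (t := t) (by nlinarith)
  have key : (t ^ 2 - 49 / 50) / π ≤ 1 / 10 := by rw [div_le_iff₀ pi_pos]; nlinarith
  rw [sigM]; linarith

/-- **Glue 2**: `M(t) ≤ σ_S(t)` on `[29/10, 3]`. [folklore] -/
theorem glue2_le {t : ℝ} (h1 : 29 / 10 ≤ t) (h2 : t ≤ 3) : sigM t ≤ sigS t := by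
  have hπ := pi_gt_three
  have := sigN_le_of_le_sq (t := 4 - t) (by nlinarith)
  have key : ((4 - t) ^ 2 - 49 / 50) / π ≤ 1 / 10 := by rw [div_le_iff₀ pi_pos]; nlinarith
  rw [sigM, sigS]; linarith

/-- **Glue 3**: `σ_S(t) ≤ t - 2` on `[61/20, 31/10]`. [folklore] -/
theorem glue3_le {t : ℝ} (h1 : 61 / 20 ≤ t) (h2 : t ≤ 31 / 10) : sigS t ≤ t - 2 := by
  have hπ := pi_gt_three
  have := sigN_ge_of_sq_le (t := 4 - t) (by nlinarith)
  have key : (49 / 50 - (4 - t) ^ 2) / π ≤ 1 - (4 - t) := by rw [div_le_iff₀ pi_pos]; nlinarith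
  rw [sigS]; linarith

/-- `loopU3' > 0`. [folklore] -/
theorem deriv_loopU3_pos (t : ℝ) : 0 < deriv loopU3 t := by
  rcases lt_or_ge t (16 / 5) with ht | ht
  · have hglue := deriv_glue_pos (f := sigS) (g := fun t => t - 2) (χ := cut (61 / 20) (31 / 10))
      (contDiff_sigS.differentiable (by simp)) (differentiable_id.sub_const 2)
      ((contDiff_cut _ _).differentiable (by simp)) (cut_nonneg _ _) (cut_le_one _ _)
      (glue_sign (by norm_num) fun x h1 h2 => glue3_le h1 h2) t
    have h1 : deriv (fun t : ℝ => t - 2) t = 1 := by rw [deriv_sub_const, deriv_id'']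
    rw [h1] at hglue
    exact lt_of_lt_of_le (lt_min (deriv_sigS_pos (by linarith)) one_pos) hglue
  · have hev : loopU3 =ᶠ[𝓝 t] fun t => t - 2 := by
      filter_upwards [Ioi_mem_nhds (show (31 / 10 : ℝ) < t by linarith)] with y hy
      rw [loopU3, cut_of_ge (by norm_num) (le_of_lt hy)]; ring
    rw [hev.deriv_eq, deriv_sub_const, deriv_id'']; exact one_pos

/-- `loopU2' > 0`. [folklore] -/
theorem deriv_loopU2_pos (t : ℝ) : 0 < deriv loopU2 t := by
  have hglue := deriv_glue_pos (f := sigM) (g := loopU3) (χ := cut (29 / 10) 3)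
    (contDiff_sigM.differentiable (by simp)) (contDiff_loopU3.differentiable (by simp))
    ((contDiff_cut _ _).differentiable (by simp)) (cut_nonneg _ _) (cut_le_one _ _)
    (glue_sign (by norm_num) fun x h1 h2 => ?_) t
  · rw [deriv_sigM] at hglue
    exact lt_of_lt_of_le (lt_min (by norm_num) (deriv_loopU3_pos t)) hglue
  · -- on `[29/10, 3]`, `loopU3 = σ_S`
    rw [loopU3, cut_of_le (by norm_num) (by linarith : x ≤ 61 / 20)]
    have := glue2_le h1 h2
    linarith

/-- `loopU1' > 0` for `t > 0`. [folklore] -/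
theorem deriv_loopU1_pos {t : ℝ} (ht : 0 < t) : 0 < deriv loopU1 t := by
  have hglue := deriv_glue_pos (f := sigN) (g := loopU2) (χ := cut 1 (11 / 10))
    (contDiff_sigN.differentiable (by simp)) (contDiff_loopU2.differentiable (by simp))
    ((contDiff_cut _ _).differentiable (by simp)) (cut_nonneg _ _) (cut_le_one _ _)
    (glue_sign (by norm_num) fun x h1 h2 => ?_) t
  · exact lt_of_lt_of_le (lt_min (deriv_sigN_pos ht) (deriv_loopU2_pos t)) hglue
  · -- on `[1, 11/10]`, `loopU2 = M`
    rw [loopU2, cut_of_le (by norm_num) (by linarith : x ≤ 29 / 10)]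
    have := glue1_le h1 h2
    linarith

/-- **`loopU' > 0` everywhere.** [folklore] -/
theorem deriv_loopU_pos (t : ℝ) : 0 < deriv loopU t := by
  rcases lt_or_ge t (9 / 10) with ht | ht
  · have hev : loopU =ᶠ[𝓝 t] fun t => t - 1 := by
      filter_upwards [Iio_mem_nhds ht] with y hy
      exact loopU_of_le (le_of_lt hy)
    rw [hev.deriv_eq, deriv_sub_const, deriv_id'']; exact one_pos
  · have hglue := deriv_glue_pos (f := fun t => t - 1) (g := loopU1) (χ := cut (9 / 10) (19 / 20))
      (differentiable_id.sub_const 1) (contDiff_loopU1.differentiable (by simp))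
      ((contDiff_cut _ _).differentiable (by simp)) (cut_nonneg _ _) (cut_le_one _ _)
      (glue_sign (by norm_num) fun x h1 h2 => ?_) t
    · have h1 : deriv (fun t : ℝ => t - 1) t = 1 := by rw [deriv_sub_const, deriv_id'']
      rw [h1] at hglue
      exact lt_of_lt_of_le (lt_min one_pos (deriv_loopU1_pos (by linarith))) hglue
    · -- on `[9/10, 19/20]`, `loopU1 = σ_N`
      rw [loopU1, cut_of_le (by norm_num) (by linarith : x ≤ 1)]
      have := glue0_le h1 h2
      linarith

/-! ### `loopU` as a diffeomorphism of `ℝ` -/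

/-- `loopU` is strictly increasing. [folklore] -/
theorem strictMono_loopU : StrictMono loopU := strictMono_of_deriv_pos deriv_loopU_pos

/-- `loopU` is surjective. [folklore] -/
theorem surjective_loopU : Surjective loopU := by
  have hcont : Continuous loopU := contDiff_loopU.continuous
  refine hcont.surjective ?_ ?_
  · have hev : loopU =ᶠ[atTop] fun t => t - 2 := by
      filter_upwards [eventually_ge_atTop (31 / 10 : ℝ)] with t ht; exact loopU_of_ge ht
    exact (tendsto_atTop_add_const_right _ _ tendsto_id).congr' hev.symm
  · have hev : loopU =ᶠ[atBot] fun t => t - 1 := by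
      filter_upwards [eventually_le_atBot (9 / 10 : ℝ)] with t ht; exact loopU_of_le ht
    exact (tendsto_atBot_add_const_right _ _ tendsto_id).congr' hev.symm

/-- **The loop coordinate as a function of the handle parameter**: `t = loopT u`, the inverse
of `loopU`. [folklore] -/
def loopT : ℝ → ℝ := (monoHomeomorph loopU strictMono_loopU surjective_loopU).symm

/-- `loopT (loopU t) = t`. [folklore] -/
@[simp] theorem loopT_loopU (t : ℝ) : loopT (loopU t) = t :=
  monoHomeomorph_symm_apply_apply _ _ _ t

/-- `loopU (loopT u) = u`. [folklore] -/
@[simp] theorem loopU_loopT (u : ℝ) : loopU (loopT u) = u := apply_monoHomeomorph_symm _ _ _ u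

/-- **`loopT` is smooth.** [folklore] -/
theorem contDiff_loopT : ContDiff ℝ ∞ loopT :=
  contDiff_monoHomeomorph_symm contDiff_loopU strictMono_loopU surjective_loopU
    fun t => (deriv_loopU_pos t).ne'

/-- `loopT` is continuous. [folklore] -/
theorem continuous_loopT : Continuous loopT := contDiff_loopT.continuous

/-! ### Values on the zones -/

/-- **The handle zone is `t ∈ (√(49/50), 4 - √(49/50))`**: `loopU t = 0 ↔ t = √(49/50)`, the
loop coordinate of the northern junction point. [folklore] -/
theorem loopU_sqrt : loopU (Real.sqrt (49 / 50)) = 0 := by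
  have h1 : (19 / 20 : ℝ) ≤ Real.sqrt (49 / 50) := by
    rw [Real.le_sqrt (by norm_num) (by norm_num)]; norm_num
  have h2 : Real.sqrt (49 / 50) ≤ 1 := Real.sqrt_le_one.mpr (by norm_num)
  rw [loopU_eq_sigN h1 h2, sigN_sqrt]

/-- `loopU (4 - √(49/50)) = 1`. [folklore] -/
theorem loopU_four_sub_sqrt : loopU (4 - Real.sqrt (49 / 50)) = 1 := by
  have h1 : (19 / 20 : ℝ) ≤ Real.sqrt (49 / 50) := by
    rw [Real.le_sqrt (by norm_num) (by norm_num)]; norm_num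
  have h2 : Real.sqrt (49 / 50) ≤ 1 := Real.sqrt_le_one.mpr (by norm_num)
  rw [loopU_eq_sigS (by linarith) (by linarith), sigS, sub_sub_cancel, sigN_sqrt, sub_zero]

/-- `0 < loopU t < 1` on the handle zone. [folklore] -/
theorem loopU_mem_Ioo {t : ℝ} (h1 : Real.sqrt (49 / 50) < t) (h2 : t < 4 - Real.sqrt (49 / 50)) :
    loopU t ∈ Ioo (0 : ℝ) 1 :=
  ⟨loopU_sqrt ▸ strictMono_loopU h1, loopU_four_sub_sqrt ▸ strictMono_loopU h2⟩

/-- On the northern junction `t ∈ [19/20, 1]`: `tan (π loopU t) = t² - 49/50`, i.e. the handle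
slice `u = loopU t` has radius `r(u) = t²`. [folklore] -/
theorem tan_pi_mul_loopU {t : ℝ} (h1 : 19 / 20 ≤ t) (h2 : t ≤ 1) :
    tan (π * loopU t) = t ^ 2 - 49 / 50 := by
  rw [loopU_eq_sigN h1 h2, tan_pi_mul_sigN]

/-- On the northern junction, `loopU t ≤ 1/500` iff essentially `t² ≤ 49/50 + tan (π/500)`; we
record the sufficient condition `t ≤ 993/1000`. [folklore] -/
theorem loopU_le_of_le {t : ℝ} (h1 : 19 / 20 ≤ t) (h2 : t ≤ 993 / 1000) : loopU t ≤ 1 / 500 := by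
  rw [loopU_eq_sigN h1 (by linarith)]
  rcases le_or_gt (t ^ 2) (49 / 50) with h | h
  · linarith [sigN_nonpos h]
  · have := sigN_le_of_le_sq h.le
    have hπ := pi_gt_d2
    have key : (t ^ 2 - 49 / 50) / π ≤ 1 / 500 := by rw [div_le_iff₀ pi_pos]; nlinarith
    linarith

/-- On the northern junction, `loopU t ≤ 1/10`. [folklore] -/
theorem loopU_le_tenth {t : ℝ} (h1 : 19 / 20 ≤ t) (h2 : t ≤ 1) : loopU t ≤ 1 / 10 := by
  rw [loopU_eq_sigN h1 h2]
  rcases le_or_gt (t ^ 2) (49 / 50) with h | h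
  · linarith [sigN_nonpos h]
  · have := sigN_le_of_le_sq h.le
    have hπ := pi_gt_three
    have key : (t ^ 2 - 49 / 50) / π ≤ 1 / 10 := by rw [div_le_iff₀ pi_pos]; nlinarith
    linarith

end IwaseTori
end Literature.Topology.FourManifolds
end
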